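import Literature.Geometry.Riemannian.L2HarmonicOneFormsSobolevProofs
import Literature.Geometry.Riemannian.EndCutoffFunctions
import Literature.Geometry.Riemannian.CompleteManifoldBoundedSets
import Literature.Geometry.Riemannian.SobolevVolumeGrowth
import Literature.Geometry.Riemannian.DirichletEnergyMinimisers
import Literature.Geometry.Riemannian.DirichletMinimiserHarmonic
import Literature.Geometry.Riemannian.DirichletMinimiserEnergy
import Literature.Geometry.Riemannian.CoerciveSchrodingerClosed
import Literature.Geometry.Riemannian.IsometryTransportSobolev
import Literature.Geometry.Riemannian.IsometryGeodesicCompleteness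
import Literature.Geometry.Manifold.BoundarylessRechart
import HarnessLib

/-!
# Carron 1998, Thm. 3.3: `k` ends and a Sobolev inequality give `k - 1` independent `L²` harmonic
# `1`-forms — assembly and discharge of `Carron1998_ends_le_rank_l2HarmonicOneForms`

Final layer of the proof programme of the named fact
`Literature.Geometry.Riemannian.Carron1998_ends_le_rank_l2HarmonicOneForms`
(`L2HarmonicOneFormsSobolev.lean`; G. Carron, *Une suite exacte en L²-cohomologie*, Duke Math.
J. 95 (1998), Thm. 0.3 = Thm. 3.3, with the proof architecture of G. Carron, arXiv:0704.3194
(2007), Lemma 2.1, Prop. 2.5, Lemma 2.7, Prop. 2.11): **a connected complete Riemannian manifold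
satisfying the Sobolev inequality `(S_p)` (`p > 2`, `μ > 0`) with at least `k` ends has
`k ≤ dim ℋ¹ + 1`.**

Part 1 (manifolds charted on `EuclideanSpace ℝ (Fin m)`, model `𝓡 m`). The steps, all proved in
the tree: cutoffs `χᵢ` of the ends (`EndCutoffFunctions.lean`); minimisation of `∫ |d(χᵢ - v)|²`
over `v ∈ C_c^∞` with `L^{2p/(p-2)}` limit `wᵢ` (`DirichletEnergyMinimisers.lean`); `uᵢ = χᵢ - wᵢ`
is distributionally harmonic (`DirichletMinimiserHarmonic.lean`), hence a.e. equal to a smooth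
harmonic `ũᵢ` (hypoellipticity, `exists_contMDiff_ae_eq_and_dalembertian_eq_of_veryWeak_smooth`,
`CoerciveSchrodingerClosed.lean`); `∫ |dũᵢ|² < ∞` (`DirichletMinimiserEnergy.lean`), so
`dũᵢ ∈ ℋ¹` (`mvfderiv_mem_l2HarmonicOneForms`); the far parts of the ends have infinite volume
(`SobolevVolumeGrowth.lean` with the far balls of `CompleteManifoldBoundedSets.lean`); and the
`dũᵢ`, `i ≠ i₀`, are independent (`linearIndependent_mvfderiv_of_ends`):
`exists_harmonic_sub_memLp`, `measure_end_diff_eq_top`,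
`exists_linearIndependent_l2HarmonicOneForms_of_ends`, `natCast_le_rank_l2HarmonicOneForms_add_one`.

Part 2 (general model). For a manifold `X` without boundary over an arbitrary real model with
corners `I : ModelWithCorners ℝ E H` we pass to the recharted copy `N = ExtRechart I e X`
(`BoundarylessRechart.lean`, `e : E ≃L[ℝ] ℝ^{dim E}`), whose identity map `Φ : N → X` is a `C^∞`
diffeomorphism, and to the transported metric `hN = Φ^* h`
(`exists_contMDiffRiemannianMetric_isIsometry`): completeness and `(S_p)` transport along the
isometry `Φ` (`IsIsometry.isGeodesicallyComplete`, `IsIsometry.hasSobolevInequality`), the ends,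
their cutoffs and the harmonic functions `ũᵢ` of the ends are produced on `N`, and the `ũᵢ` are
harmonic with the same finite Dirichlet energy on `X` (`IsIsometry.dalembertian_comp`,
`IsIsometry.lintegral_innerDual_mvfderiv_comp`), so that `dũᵢ ∈ ℋ¹(X, h)` and the `dũᵢ`,
`i ≠ i₀`, are independent on `X`: `Carron1998_ends_le_rank_l2HarmonicOneForms_holds`.
Zero-dimensional connected manifolds are compact and have no ends
(`compactSpace_of_finrank_eq_zero`, `not_hasAtLeastEnds_of_finrank_zero`).

Everything is proved; no definitions, no named facts (D-0026).

## References

* G. Carron, *Une suite exacte en L²-cohomologie*, Duke Math. J. 95 (1998) 343–372, Thm. 0.3 =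
  Thm. 3.3. [`Carron1998`]
* G. Carron, *L² harmonic forms on non-compact Riemannian manifolds*, arXiv:0704.3194 (2007),
  Lemma 2.1, Prop. 2.5, Remark 2.6, Lemma 2.7, Prop. 2.11. [`Carron2007`]
-/

noncomputable section

open Bundle Set Function Filter Topology MeasureTheory Manifold
open scoped Manifold ContDiff ENNReal NNReal

namespace Literature.Geometry.Riemannian


open Literature.Geometry.Lorentzian
open Literature.Geometry.Lorentzian.PseudoRiemannianMetric

/-! ### Zero-dimensional manifolds have no ends -/

/-- A connected manifold charted on the one-point space `EuclideanSpace ℝ (Fin 0)` is compact (every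
chart domain is an open singleton, so the topology is discrete, and a discrete connected space has
at most one point); hence it has no end. [folklore] -/
theorem not_hasAtLeastEnds_of_finrank_zero {N : Type*} [TopologicalSpace N]
    [ChartedSpace (EuclideanSpace ℝ (Fin 0)) N] [ConnectedSpace N] (k : ℕ) :
    ¬ HasAtLeastEnds N (k + 1) := by
  -- singletons are open
  have hopen : ∀ x : N, IsOpen ({x} : Set N) := by
    intro x
    have hsub : (chartAt (EuclideanSpace ℝ (Fin 0)) x).source ⊆ {x} := by
      intro y hy
      have h1 : chartAt (EuclideanSpace ℝ (Fin 0)) x y = chartAt (EuclideanSpace ℝ (Fin 0)) x x :=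
        Subsingleton.elim _ _
      exact (chartAt (EuclideanSpace ℝ (Fin 0)) x).injOn hy (mem_chart_source _ x) h1
    have heq : (chartAt (EuclideanSpace ℝ (Fin 0)) x).source = {x} :=
      Subset.antisymm hsub (singleton_subset_iff.2 (mem_chart_source _ x))
    rw [← heq]
    exact (chartAt (EuclideanSpace ℝ (Fin 0)) x).open_source
  haveI : DiscreteTopology N := ⟨eq_bot_of_singletons_open hopen⟩
  haveI : Subsingleton N := by
    refine ⟨fun x y ↦ ?_⟩
    by_contra hxy
    have hclopen : IsClopen ({x} : Set N) := ⟨isClosed_discrete _, hopen x⟩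
    have := isClopen_iff.1 hclopen
    rcases this with h0 | h1
    · exact (singleton_nonempty x).ne_empty h0
    · exact hxy (mem_singleton_iff.1 (h1 ▸ mem_univ y)).symm
  haveI : CompactSpace N := Finite.compactSpace
  exact not_hasAtLeastEnds_succ N k

/-! ### The main theorem on `𝓡 m`-charted manifolds -/

section Main

variable {m : ℕ} {N : Type*} [TopologicalSpace N] [ChartedSpace (EuclideanSpace ℝ (Fin m)) N]
  [IsManifold (𝓡 m) ∞ N] [T3Space N] [SecondCountableTopology N] [ConnectedSpace N]
  [MeasurableSpace N] [BorelSpace N]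
  (h : ContMDiffRiemannianMetric (𝓡 m) ∞ (EuclideanSpace ℝ (Fin m)) (TangentSpace (𝓡 m) : N → Type _))
  [(ofRiemannian h).HasLeviCivita]

omit [ConnectedSpace N] in
/-- **One end, one harmonic function** (Carron 2007, Prop. 2.5 with Prop. 2.11 and Remark 2.6, in
the variational form of this tree). Let `(N, h)` satisfy `(S_p)` (`p > 2`, `μ > 0`) and let
`χ ∈ C^∞(N)` be locally constant off a compact set. Then there are `ũ ∈ C^∞(N)` harmonic with
`∫ |dũ|²_h < ∞` and `w ∈ L^q(dV_h)`, `q = 2p/(p-2)`, with `ũ = χ - w` almost everywhere.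
[cite: Carron2007, Prop. 2.5] -/
theorem exists_harmonic_sub_memLp {p μ : ℝ} (hp : 2 < p) (hμ : 0 < μ) (hm : m ≠ 0)
    (hS : HasSobolevInequality h p μ) {χ : N → ℝ} (hχ : ContMDiff (𝓡 m) 𝓘(ℝ, ℝ) ∞ χ)
    {K₁ : Set N} (hK₁ : IsCompact K₁) (hχK : ∀ x ∉ K₁, mvfderiv (𝓡 m) χ x = 0) :
    ∃ (ũ w : N → ℝ), ContMDiff (𝓡 m) 𝓘(ℝ, ℝ) ∞ ũ ∧
      (∀ x, (ofRiemannian h).dalembertian ũ x = 0) ∧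
      ∫⁻ x, ENNReal.ofReal ((ofRiemannian h).innerDual x (mvfderiv (𝓡 m) ũ x).toLinearMap
        (mvfderiv (𝓡 m) ũ x).toLinearMap) ∂riemannianMeasure h < ⊤ ∧
      MemLp w (ENNReal.ofReal (2 * p / (p - 2))) (riemannianMeasure h) ∧
      ∀ᵐ x ∂riemannianMeasure h, ũ x = χ x - w x := by
  haveI : LocallyCompactSpace N := Manifold.locallyCompact_of_finiteDimensional (𝓡 m)
  haveI : IsFiniteMeasureOnCompacts (riemannianMeasure h) :=
    ⟨fun K hK ↦ riemannianVolume_lt_top_of_isCompact_holds h le_rfl hK⟩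
  haveI : IsLocallyFiniteMeasure (riemannianMeasure h) := inferInstance
  haveI : Nontrivial (EuclideanSpace ℝ (Fin m)) := by
    refine ⟨⟨EuclideanSpace.single ⟨0, Nat.pos_of_ne_zero hm⟩ (1 : ℝ), 0, fun h0 ↦ ?_⟩⟩
    have := congrArg (fun f : EuclideanSpace ℝ (Fin m) ↦ f ⟨0, Nat.pos_of_ne_zero hm⟩) h0
    simp at this
  set ν : Measure N := riemannianMeasure h with hν
  set q : ℝ≥0∞ := ENNReal.ofReal (2 * p / (p - 2)) with hq
  have hp2 : 0 < p - 2 := by linarith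
  have hq1 : 1 ≤ q := by
    rw [hq, ← ENNReal.ofReal_one]
    refine ENNReal.ofReal_le_ofReal ?_
    rw [le_div_iff₀ hp2]; linarith
  -- minimising sequence and `L^q` limit
  obtain ⟨m₀, v, w₀, hvs, hvc, -, hE, hw₀, hlim₀, hvar⟩ :=
    exists_dirichlet_minimising_limit h hp hμ hS hχ hK₁ hχK
  -- a measurable modification `w` of `w₀`
  set w : N → ℝ := hw₀.1.mk w₀ with hwdef
  have hww₀ : w₀ =ᵐ[ν] w := hw₀.1.ae_eq_mk
  have hwm : Measurable w := hw₀.1.stronglyMeasurable_mk.measurable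
  have hw : MemLp w q ν := hw₀.ae_eq hww₀
  have hlim : Tendsto (fun n ↦ eLpNorm (v n - w) q ν) atTop (𝓝 0) := by
    refine hlim₀.congr fun n ↦ eLpNorm_congr_ae ?_
    filter_upwards [hww₀] with x hx
    simp [hx]
  -- distributional harmonicity of `u = χ - w`
  have hdist : ∀ ζ : N → ℝ, ContMDiff (𝓡 m) 𝓘(ℝ, ℝ) ∞ ζ → HasCompactSupport ζ →
      ∫ x, (χ x - w x) * (ofRiemannian h).dalembertian ζ x ∂ν = 0 := fun ζ hζ hζc ↦
    integral_sub_mul_dalembertian_eq_zero h hχ hvs hvc hq1 hw hlim hvar hζ hζc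
  -- regularity: a smooth harmonic representative
  have hum : Measurable fun x ↦ χ x - w x := hχ.continuous.measurable.sub hwm
  have huli : LocallyIntegrable (fun x ↦ χ x - w x) ν :=
    (hχ.continuous.locallyIntegrable).sub (hw.locallyIntegrable hq1)
  have hweak : ∀ ζ : N → ℝ, ContMDiff (𝓡 m) 𝓘(ℝ, ℝ) ∞ ζ → HasCompactSupport ζ →
      ∫ x, (χ x - w x) * ((ofRiemannian h).dalembertian ζ x - (0 : N → ℝ) x * ζ x) ∂ν =
        ∫ x, (0 : N → ℝ) x * ζ x ∂ν := by
    intro ζ hζ hζc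
    simp only [Pi.zero_apply, zero_mul, sub_zero, integral_zero]
    exact hdist ζ hζ hζc
  obtain ⟨ũ, hũs, hae, hΔ'⟩ := exists_contMDiff_ae_eq_and_dalembertian_eq_of_veryWeak_smooth h hum
    huli (f := 0) (g := 0) contMDiff_const contMDiff_const hweak
  have hΔ : ∀ x, (ofRiemannian h).dalembertian ũ x = 0 := fun x ↦ by
    have := hΔ' x
    simpa using this
  -- the energy bound
  have hconv : ∀ F : N → ℝ, Continuous F → HasCompactSupport F →
      Tendsto (fun n ↦ ∫ x, ((χ x - v n x) - ũ x) * F x ∂ν) atTop (𝓝 0) := by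
    intro F hFc hFs
    obtain ⟨C, hC⟩ := hFc.bounded_above_of_compact_support hFs
    have hvq : ∀ n, MemLp (v n) q ν := fun n ↦
      (hvs n).continuous.memLp_of_hasCompactSupport (hvc n)
    obtain ⟨-, hT⟩ := tendsto_integral_sub_mul_of_tendsto_eLpNorm (ν := ν) hq1 hvq hw hlim
      (isClosed_tsupport F).measurableSet hFs.isCompact.measure_lt_top (le_max_right C 0)
      (fun x ↦ by
        have h1 := hC x
        rw [Real.norm_eq_abs] at h1
        exact h1.trans (le_max_left _ _))
      (fun x hx ↦ image_eq_zero_of_notMem_tsupport hx) hFc.aestronglyMeasurable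
    have heq : ∀ n, ∫ x, ((χ x - v n x) - ũ x) * F x ∂ν = -∫ x, (v n x - w x) * F x ∂ν := by
      intro n
      rw [← integral_neg]
      refine integral_congr_ae ?_
      filter_upwards [hae] with x hx
      have : ũ x = χ x - w x := hx.symm
      rw [this]; ring
    simp_rw [heq]
    simpa using hT.neg
  have hcut : ∀ φ : N → ℝ, ContMDiff (𝓡 m) 𝓘(ℝ, ℝ) ∞ φ → HasCompactSupport φ →
      (∀ x, 0 ≤ φ x) → (∀ x, φ x ≤ 1) →
      ∫ x, φ x * (ofRiemannian h).gradSq ũ x ∂ν ≤ m₀ := fun φ hφ hφc hφ0 hφ1 ↦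
    integral_mul_gradSq_le_of_tendsto h hχ hũs hΔ hvs hvc hK₁ hχK hE hconv hφ hφc hφ0 hφ1
  have hũ1 : ContMDiff (𝓡 m) 𝓘(ℝ, ℝ) 1 ũ := by exact_mod_cast contMDiff_infty.1 hũs 1
  have hGc : Continuous ((ofRiemannian h).gradSq ũ) := continuous_innerDual_mvfderiv _ hũ1 hũ1
  have hG0 : ∀ x, 0 ≤ (ofRiemannian h).gradSq ũ x := fun x ↦ innerDual_self_nonneg (h := h) x _
  have hL2 := lintegral_ofReal_le_of_forall_cutoff h hGc hG0 hcut
  refine ⟨ũ, w, hũs, hΔ, lt_of_le_of_lt hL2 ENNReal.ofReal_lt_top, hw, ?_⟩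
  filter_upwards [hae] with x hx
  exact hx.symm

/-- **The far part of an end has infinite volume** (Carron 2007, Lemma 2.7 with the volume bound
of Prop. 2.11): on a connected complete `(N, h)` charted on `ℝᵐ` with `(S_p)`, if `C` is the
connected component in `N ∖ K` of each of its points (`K` compact), `W ⊇ K` is compact and
`C ∖ W` has non-compact closure, then `vol_h (C ∖ W) = ∞` (far balls of every radius,
`exists_setOf_edist_lt_subset_diff`, and `measure_eq_top_of_forall_exists_ball_subset`).
[cite: Carron2007, Lemma 2.7] -/
theorem measure_end_diff_eq_top {p μ : ℝ} (hp : 2 < p) (hμ : 0 < μ)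
    (hc : IsGeodesicallyComplete (ofRiemannian h).leviCivita) (hS : HasSobolevInequality h p μ)
    {K W C : Set N} (hW : IsCompact W) (hKW : K ⊆ W)
    (hC : ∀ x ∈ C, connectedComponentIn Kᶜ x = C) (hfar : ¬ IsCompact (closure (C \ W))) :
    riemannianMeasure h (C \ W) = ⊤ := by
  haveI := contMDiffCovariantDerivative_leviCivita_ofRiemannian_one h
  have hg : (ofRiemannian h).IsRiemannian := isRiemannian_ofRiemannian h
  refine measure_eq_top_of_forall_exists_ball_subset h hc hp hμ hS fun r ↦ ?_
  obtain ⟨x, -, hx⟩ := exists_setOf_edist_lt_subset_diff (ofRiemannian h) le_rfl hg hc hW hKW hC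
    hfar r
  exact ⟨x, hx⟩

/-- **Carron 1998, Thm. 3.3 (first assertion made quantitative), for manifolds charted on `ℝᵐ`.**
Let `(N, h)` be a connected complete Riemannian manifold charted on `EuclideanSpace ℝ (Fin m)`
satisfying the Sobolev inequality `(S_p)` with constant `μ > 0` for some `p > 2`. If `N` has at
least `k ≥ 2` ends, then `ℋ¹(N, h)` contains `k - 1` linearly independent `L²` harmonic `1`-forms
(the differentials `dũᵢ` of the harmonic functions of `k - 1` of the ends). Carron 1998, Thm. 3.3
(proof, p. 21–22); Carron 2007, Lemma 2.1, Prop. 2.5, Lemma 2.7, Prop. 2.11.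
[cite: Carron1998, Thm. 3.3] -/
theorem exists_linearIndependent_l2HarmonicOneForms_of_ends {p μ : ℝ} (hp : 2 < p) (hμ : 0 < μ)
    (hc : IsGeodesicallyComplete (ofRiemannian h).leviCivita) (hS : HasSobolevInequality h p μ)
    {k : ℕ} (hk : 2 ≤ k) (hends : HasAtLeastEnds N k) :
    ∃ v : Fin (k - 1) → l2HarmonicOneForms h, LinearIndependent ℝ v := by
  classical
  -- dimension `0`: no ends
  rcases Nat.eq_zero_or_pos m with hm | hm
  · subst hm
    obtain ⟨k', rfl⟩ : ∃ k', k = k' + 1 := ⟨k - 1, by omega⟩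
    exact absurd hends (not_hasAtLeastEnds_of_finrank_zero (N := N) k')
  have hm0 : m ≠ 0 := hm.ne'
  haveI : LocallyCompactSpace N := Manifold.locallyCompact_of_finiteDimensional (𝓡 m)
  haveI : IsManifold (𝓡 m) 1 N := IsManifold.of_le (n := ∞) (by norm_num)
  set ν : Measure N := riemannianMeasure h with hν
  set q : ℝ≥0∞ := ENNReal.ofReal (2 * p / (p - 2)) with hq
  have hp2 : 0 < p - 2 := by linarith
  have hq0 : q ≠ 0 := by
    rw [hq]; exact (ENNReal.ofReal_pos.2 (div_pos (by linarith) hp2)).ne'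
  have hqtop : q ≠ ⊤ := ENNReal.ofReal_ne_top
  -- the ends and their cutoffs
  obtain ⟨K, V, C, χ, hK, hVo, hKV, hVc, hCo, -, hCeq, -, hfar, hχs, -, hχδ, -, hχloc⟩ :=
    hends.exists_end_cutoffs (I := 𝓡 m)
  have hχK : ∀ i, ∀ x ∉ closure V, mvfderiv (𝓡 m) (χ i) x = 0 := by
    intro i x hx
    rw [mvfderiv_eq_zero_iff, (hχloc i x hx).mfderiv_eq]
    exact mfderiv_const
  -- the harmonic functions of the ends
  have hharm : ∀ i : Fin k, ∃ (ũ w : N → ℝ), ContMDiff (𝓡 m) 𝓘(ℝ, ℝ) ∞ ũ ∧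
      (∀ x, (ofRiemannian h).dalembertian ũ x = 0) ∧
      ∫⁻ x, ENNReal.ofReal ((ofRiemannian h).innerDual x (mvfderiv (𝓡 m) ũ x).toLinearMap
        (mvfderiv (𝓡 m) ũ x).toLinearMap) ∂ν < ⊤ ∧
      MemLp w q ν ∧ ∀ᵐ x ∂ν, ũ x = χ i x - w x := fun i ↦
    exists_harmonic_sub_memLp h hp hμ hm0 hS (hχs i) hVc (hχK i)
  choose ũ w hũs hΔ hL2 hw hae using hharm
  -- membership in `ℋ¹`
  have hmem : ∀ i, mvfderiv (𝓡 m) (ũ i) ∈ l2HarmonicOneForms h := fun i ↦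
    mvfderiv_mem_l2HarmonicOneForms h (contMDiff_oneFormSection_mvfderiv (hũs i))
      (fun x ↦ by exact_mod_cast (contMDiff_infty.1 (hũs i) 2) x) (hΔ i) (hL2 i)
  -- the far parts of the ends have infinite volume
  have hvol : ∀ j : Fin k, ν (C j \ closure V) = ⊤ := fun j ↦
    measure_end_diff_eq_top h hp hμ hc hS hVc (hKV.trans subset_closure) (hCeq j) (hfar j)
  -- independence of the differentials `dũᵢ`, `i ≠ i₀`
  have hkpos : 0 < k := by omega
  set i₀ : Fin k := ⟨0, hkpos⟩ with hi₀
  have hCm : ∀ j : Fin k, MeasurableSet (C j \ closure V) := fun j ↦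
    (hCo j).measurableSet.diff isClosed_closure.measurableSet
  have hli : LinearIndependent ℝ fun i : {i : Fin k // i ≠ i₀} ↦ mvfderiv (𝓡 m) (ũ i.1) :=
    linearIndependent_mvfderiv_of_ends (I := 𝓡 m) (μ := ν) hCm hvol (u := ũ) (χ := χ) (v := w)
      hχδ (fun i ↦ hae i) (fun i ↦ (hw i).1) hq0 hqtop (fun i ↦ (hw i).eLpNorm_lt_top)
      (fun i x ↦ ((hũs i) x).mdifferentiableAt (by simp)) i₀
  -- into the submodule, reindexed by `Fin (k - 1)`
  set F : {i : Fin k // i ≠ i₀} → l2HarmonicOneForms h := fun i ↦ ⟨mvfderiv (𝓡 m) (ũ i.1), hmem i.1⟩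
    with hF
  have hliF : LinearIndependent ℝ F := by
    refine LinearIndependent.of_comp (l2HarmonicOneForms h).subtype ?_
    exact hli
  have hcard : Fintype.card {i : Fin k // i ≠ i₀} = k - 1 := by
    rw [Fintype.card_subtype_compl, Fintype.card_fin, Fintype.card_subtype_eq]
  set e : {i : Fin k // i ≠ i₀} ≃ Fin (k - 1) := Fintype.equivFinOfCardEq hcard with he
  exact ⟨F ∘ e.symm, hliF.comp e.symm e.symm.injective⟩

/-- **Corollary: `k ≤ dim ℋ¹(N, h) + 1`** under the hypotheses of
`exists_linearIndependent_l2HarmonicOneForms_of_ends`, for any number `k` of ends (void for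
`k ≤ 1`) — the conclusion of `Carron1998_ends_le_rank_l2HarmonicOneForms` for manifolds charted on
`ℝᵐ`. [cite: Carron1998, Thm. 3.3] -/
theorem natCast_le_rank_l2HarmonicOneForms_add_one {p μ : ℝ} (hp : 2 < p) (hμ : 0 < μ)
    (hc : IsGeodesicallyComplete (ofRiemannian h).leviCivita) (hS : HasSobolevInequality h p μ)
    (k : ℕ) (hends : HasAtLeastEnds N k) :
    (k : Cardinal) ≤ Module.rank ℝ (l2HarmonicOneForms h) + 1 := by
  rcases lt_or_ge k 2 with hk2 | hk2
  · calc (k : Cardinal) ≤ 1 := by exact_mod_cast Nat.lt_succ_iff.1 hk2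
      _ ≤ Module.rank ℝ (l2HarmonicOneForms h) + 1 := le_add_self
  · obtain ⟨v, hv⟩ := exists_linearIndependent_l2HarmonicOneForms_of_ends h hp hμ hc hS hk2 hends
    exact natCast_le_rank_add_one_of_linearIndependent (K := ℝ) (V := l2HarmonicOneForms h) hv

end Main



open Literature.Geometry.Manifold

/-! ### Zero-dimensional manifolds are compact -/

/-- A connected manifold over a model vector space of dimension `0` is compact: the model space
`H ↪ E = {0}` has at most one point, so every chart domain is an open singleton, the topology is
discrete and a discrete connected space has at most one point. [folklore] -/
theorem compactSpace_of_finrank_eq_zero {E : Type*} [NormedAddCommGroup E] [NormedSpace ℝ E]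
    [FiniteDimensional ℝ E] {H : Type*} [TopologicalSpace H] (I : ModelWithCorners ℝ E H)
    (X : Type*) [TopologicalSpace X] [ChartedSpace H X] [ConnectedSpace X]
    (hE : Module.finrank ℝ E = 0) : CompactSpace X := by
  haveI : Subsingleton E := Module.finrank_zero_iff.1 hE
  have hH : ∀ a b : H, a = b := fun a b ↦ I.injective (Subsingleton.elim _ _)
  have hopen : ∀ x : X, IsOpen ({x} : Set X) := by
    intro x
    have hsub : (chartAt H x).source ⊆ {x} := fun y hy ↦
      (chartAt H x).injOn hy (mem_chart_source _ x) (hH _ _)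
    have heq : (chartAt H x).source = {x} :=
      Subset.antisymm hsub (singleton_subset_iff.2 (mem_chart_source _ x))
    rw [← heq]
    exact (chartAt H x).open_source
  haveI : DiscreteTopology X := ⟨eq_bot_of_singletons_open hopen⟩
  haveI : Subsingleton X := by
    refine ⟨fun x y ↦ ?_⟩
    by_contra hxy
    rcases isClopen_iff.1 ⟨isClosed_discrete _, hopen x⟩ with h0 | h1
    · exact (singleton_nonempty x).ne_empty h0
    · exact hxy (mem_singleton_iff.1 (h1 ▸ mem_univ y)).symm
  exact Finite.compactSpace

/-! ### The discharge -/

/-- **Carron 1998, Thm. 3.3 (`k` ends ⇒ `dim ℋ¹ ≥ k - 1`), discharged**: the named fact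
`Carron1998_ends_le_rank_l2HarmonicOneForms` holds. The proof recharts the boundaryless
manifold `X` over `ℝ^{dim E}` (`ExtRechart`), transports metric, completeness and `(S_p)` along
the identity diffeomorphism, produces the harmonic functions of the ends there
(`exists_harmonic_sub_memLp`, `measure_end_diff_eq_top`), and reads them back on `X`, where
their differentials are `k - 1` independent elements of `ℋ¹(X, h)`. Carron 1998, Thm. 3.3;
Carron 2007, Lemma 2.1, Prop. 2.5, Lemma 2.7, Prop. 2.11. [cite: Carron1998, Thm. 3.3] -/
theorem Carron1998_ends_le_rank_l2HarmonicOneForms_holds :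
    Carron1998_ends_le_rank_l2HarmonicOneForms := by
  intro E _ _ _ H _ I X _ _ _ _ _ _ _ _ _ h _ p μ hp hμ hc hS k hends
  classical
  -- `k ≤ 1` is trivial
  rcases lt_or_ge k 2 with hk2 | hk2
  · calc (k : Cardinal) ≤ 1 := by exact_mod_cast Nat.lt_succ_iff.1 hk2
      _ ≤ Module.rank ℝ (l2HarmonicOneForms h) + 1 := le_add_self
  -- positive dimension
  rcases Nat.eq_zero_or_pos (Module.finrank ℝ E) with hE0 | hEpos
  · haveI := compactSpace_of_finrank_eq_zero I X hE0
    obtain ⟨k', rfl⟩ : ∃ k', k = k' + 1 := ⟨k - 1, by omega⟩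
    exact absurd hends (not_hasAtLeastEnds_succ X k')
  -- recharting over `ℝ^m`, `m = dim E`
  set m : ℕ := Module.finrank ℝ E with hm
  have hdim : Module.finrank ℝ (EuclideanSpace ℝ (Fin m)) = Module.finrank ℝ E := by simp [hm]
  set e : E ≃L[ℝ] EuclideanSpace ℝ (Fin m) := ContinuousLinearEquiv.ofFinrankEq hdim.symm with he
  haveI : IsManifold I 1 X := IsManifold.of_le (n := ∞) (by norm_num)
  set Φ : Diffeomorph 𝓘(ℝ, EuclideanSpace ℝ (Fin m)) I (ExtRechart I e X) X ∞ := ExtRechart.toOrig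
    with hΦdef
  obtain ⟨hN, hΦ⟩ := exists_contMDiffRiemannianMetric_isIsometry Φ hdim h
  haveI : Fact ((1 : ℕ∞ω) ≤ ((⊤ : ℕ∞) : ℕ∞ω)) := ⟨by exact_mod_cast le_top⟩
  haveI : CompleteSpace (EuclideanSpace ℝ (Fin m)) := inferInstance
  haveI : (ofRiemannian hN).HasLeviCivita := PseudoRiemannianMetric.hasLeviCivita _
  -- transport of completeness, of `(S_p)` and of the ends
  have hcN : IsGeodesicallyComplete (ofRiemannian hN).leviCivita := hΦ.isGeodesicallyComplete hdim hc
  have hSN : HasSobolevInequality hN p μ := hΦ.hasSobolevInequality hS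
  have hendsN : HasAtLeastEnds (ExtRechart I e X) k := hends
  have hm0 : m ≠ 0 := hEpos.ne'
  -- notation
  set N := ExtRechart I e X with hNdef
  set νN : Measure N := riemannianMeasure hN with hνN
  set νX : Measure X := riemannianMeasure h with hνX
  set q : ENNReal := ENNReal.ofReal (2 * p / (p - 2)) with hq
  have hp2 : 0 < p - 2 := by linarith
  have hq0 : q ≠ 0 := by rw [hq]; exact (ENNReal.ofReal_pos.2 (div_pos (by linarith) hp2)).ne'
  have hqtop : q ≠ ⊤ := ENNReal.ofReal_ne_top
  have hmp : MeasurePreserving Φ νN νX := hΦ.measurePreserving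
  have hmps : MeasurePreserving Φ.symm νX νN := by
    refine ⟨Φ.symm.continuous.measurable, ?_⟩
    rw [← hmp.map_eq, Measure.map_map Φ.symm.continuous.measurable Φ.continuous.measurable]
    have hid : (Φ.symm : X → N) ∘ Φ = id := funext fun y ↦ Φ.symm_apply_apply y
    rw [hid, Measure.map_id]
  -- ends and cutoffs, read on `N`
  obtain ⟨K, V, C, χ, hK, hVo, hKV, hVc, hCo, -, hCeq, -, hfar, hχs, -, hχδ, -, hχloc⟩ :=
    hendsN.exists_end_cutoffs (I := 𝓘(ℝ, EuclideanSpace ℝ (Fin m)))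
  have hχK : ∀ i, ∀ x ∉ closure V, mvfderiv 𝓘(ℝ, EuclideanSpace ℝ (Fin m)) (χ i) x = 0 := by
    intro i x hx
    rw [mvfderiv_eq_zero_iff, (hχloc i x hx).mfderiv_eq]
    exact mfderiv_const
  -- the harmonic functions of the ends, on `N`
  have hharm : ∀ i : Fin k, ∃ (ũ w : N → ℝ), ContMDiff 𝓘(ℝ, EuclideanSpace ℝ (Fin m)) 𝓘(ℝ, ℝ) ∞ ũ ∧
      (∀ x, (ofRiemannian hN).dalembertian ũ x = 0) ∧
      ∫⁻ x, ENNReal.ofReal ((ofRiemannian hN).innerDual x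
        (mvfderiv 𝓘(ℝ, EuclideanSpace ℝ (Fin m)) ũ x).toLinearMap
        (mvfderiv 𝓘(ℝ, EuclideanSpace ℝ (Fin m)) ũ x).toLinearMap) ∂νN < ⊤ ∧
      MemLp w q νN ∧ ∀ᵐ x ∂νN, ũ x = χ i x - w x := fun i ↦
    exists_harmonic_sub_memLp hN hp hμ hm0 hSN (hχs i) hVc (hχK i)
  choose ũ w hũs hΔ hL2 hw hae using hharm
  -- the far parts of the ends have infinite volume (on `N`, hence on `X`)
  have hvolN : ∀ j : Fin k, νN (C j \ closure V) = ⊤ := fun j ↦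
    measure_end_diff_eq_top hN hp hμ hcN hSN hVc (hKV.trans subset_closure) (hCeq j) (hfar j)
  -- back on `X`: the functions `uᵢ = ũᵢ ∘ Φ⁻¹`
  set u : Fin k → X → ℝ := fun i ↦ ũ i ∘ Φ.symm with hu
  have huΦ : ∀ i, u i ∘ Φ = ũ i := fun i ↦ funext fun y ↦ by simp [hu]
  have hus : ∀ i, ContMDiff I 𝓘(ℝ, ℝ) ∞ (u i) := fun i ↦ (hũs i).comp Φ.symm.contMDiff
  have hud : ∀ i x, MDiffAt (u i) x := fun i x ↦ ((hus i) x).mdifferentiableAt (by simp)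
  have hΔX : ∀ i x, (ofRiemannian h).dalembertian (u i) x = 0 := by
    intro i x
    have h2 : CMDiffAt 2 (u i) (Φ (Φ.symm x)) :=
      ((hus i) _).of_le (by exact WithTop.coe_le_coe.mpr le_top)
    have := hΦ.dalembertian_comp hdim h2
    rw [Φ.apply_symm_apply] at this
    rw [← this, huΦ i]
    exact hΔ i _
  have hL2X : ∀ i, ∫⁻ x, ENNReal.ofReal ((ofRiemannian h).innerDual x
      (mvfderiv I (u i) x).toLinearMap (mvfderiv I (u i) x).toLinearMap) ∂νX < ⊤ := by
    intro i
    rw [hνX, ← hΦ.lintegral_innerDual_mvfderiv_comp (hud i), huΦ i]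
    exact hL2 i
  -- membership in `ℋ¹(X, h)`
  have hmem : ∀ i, mvfderiv I (u i) ∈ l2HarmonicOneForms h := fun i ↦
    mvfderiv_mem_l2HarmonicOneForms h (contMDiff_oneFormSection_mvfderiv (hus i))
      (fun x ↦ ((hus i) x).of_le (by exact WithTop.coe_le_coe.mpr le_top)) (hΔX i) (hL2X i)
  -- the data of `linearIndependent_mvfderiv_of_ends`, on `X`
  set CX : Fin k → Set X := fun j ↦ Φ.symm ⁻¹' (C j \ closure V) with hCX
  have hCXm : ∀ j, MeasurableSet (CX j) := fun j ↦
    ((hCo j).measurableSet.diff isClosed_closure.measurableSet).preimage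
      Φ.symm.toHomeomorph.measurable
  have hvolX : ∀ j, νX (CX j) = ⊤ := by
    intro j
    rw [hCX]
    show νX (Φ.symm ⁻¹' (C j \ closure V)) = ⊤
    rw [← hvolN j, ← hmps.map_eq, Measure.map_apply Φ.symm.continuous.measurable
      ((hCo j).measurableSet.diff isClosed_closure.measurableSet)]
  set χX : Fin k → X → ℝ := fun i ↦ χ i ∘ Φ.symm with hχX
  set wX : Fin k → X → ℝ := fun i ↦ w i ∘ Φ.symm with hwX
  have hχXδ : ∀ i j, ∀ x ∈ CX j, χX i x = if i = j then 1 else 0 := fun i j x hx ↦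
    hχδ i j (Φ.symm x) hx
  have huv : ∀ i, ∀ᵐ x ∂νX, u i x = χX i x - wX i x := by
    intro i
    have := (hΦ.ae_comp_iff (P := fun x ↦ u i x = χX i x - wX i x)).1
    refine this ?_
    filter_upwards [hae i] with y hy
    show u i (Φ y) = χX i (Φ y) - wX i (Φ y)
    simp only [hu, hχX, hwX, Function.comp_apply, Diffeomorph.symm_apply_apply]
    exact hy
  have hwXm : ∀ i, MemLp (wX i) q νX := fun i ↦ (hw i).comp_measurePreserving hmps
  have hli : LinearIndependent ℝ fun i : {i : Fin k // i ≠ ⟨0, by omega⟩} ↦ mvfderiv I (u i.1) :=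
    linearIndependent_mvfderiv_of_ends (I := I) (μ := νX) hCXm hvolX (u := u) (χ := χX) (v := wX)
      hχXδ huv (fun i ↦ (hwXm i).1) hq0 hqtop (fun i ↦ (hwXm i).eLpNorm_lt_top) hud ⟨0, by omega⟩
  -- into the submodule, reindexed by `Fin (k - 1)`
  set i₀ : Fin k := ⟨0, by omega⟩ with hi₀
  set F : {i : Fin k // i ≠ i₀} → l2HarmonicOneForms h := fun i ↦ ⟨mvfderiv I (u i.1), hmem i.1⟩
    with hF
  have hliF : LinearIndependent ℝ F := by
    refine LinearIndependent.of_comp (l2HarmonicOneForms h).subtype ?_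
    exact hli
  have hcard : Fintype.card {i : Fin k // i ≠ i₀} = k - 1 := by
    rw [Fintype.card_subtype_compl, Fintype.card_fin, Fintype.card_subtype_eq]
  set ε : {i : Fin k // i ≠ i₀} ≃ Fin (k - 1) := Fintype.equivFinOfCardEq hcard with hε
  have hv : LinearIndependent ℝ (F ∘ ε.symm) := hliF.comp ε.symm ε.symm.injective
  exact natCast_le_rank_add_one_of_linearIndependent (K := ℝ) (V := l2HarmonicOneForms h) hv

end Literature.Geometry.Riemannian

end
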